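import Mathlib
import Summits.CriticalPhenomena.SAWScalingLimit.Theorems.SAWDefectDecoherenceSectorSlavingDefs
import Summits.CriticalPhenomena.SAWScalingLimit.Theorems.SAWDefectDecoherenceDefectDecoherenceTmStarSums
import Summits.CriticalPhenomena.SAWScalingLimit.Theorems.SAWDefectDecoherenceSpinShift
import Summits.CriticalPhenomena.SAWScalingLimit.Theorems.SAWDefectDecoherenceDefectDecoherenceSsTipRegroupingAux1
import Summits.CriticalPhenomena.SAWScalingLimit.Theorems.SAWDefectDecoherenceDefectDecoherenceSsTipRegroupingAux2
import HarnessLib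

/-!
# The exact `D`-row of the sector system (stub `stub_sectorRowD` of the line `sector-slaving`,
crux `DefectDecoherence`, stmt-CriticalPhenomena-8549)

At a `2`-deep vertex `v` of `Λ`, for an adjacent boundary root `a = s(u,w)` (`u ∉ Λ ∋ w`), the full
via-dart sum of the defect character satisfies `Ā_D(v) = rowD(v)`:
`Ā_{13/8}(v) = Σ_{t ∼ v} [(1/3) ē(t)² U(t) + (2x_c cos(5π/24)/3) ē(t) S(t) + (2x_c cos(13π/24)/3) D(t)]`,
`e(t) = dartUnit v t`, `U, S, D = A_{-3/8}, A_{5/8}, A_{13/8}` the clean arrival sums at `t`.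

Proof.  ONE STEP: a via-`t` walk at `mid{t,v}` (last vertex `t`) is a clean arrival `ω` at `t` through
a dart `s → t`, `s ∈ star Λ t ∖ {v}`, prolonged by `t` (`tip_sum_viaV` read at the vertex `t`, in the
swapped orientation `s(v,t)`); the prolongation adds the turn `τ(s) = ±π/3` to the winding
(`tip_winding_snoc`) and one factor `x_c`.  LIFTED DIRECTION: `e^{iΘ(ω)} = d_s := dartUnit t s`
(`tip_exp_lifted_direction`), so the three characters of one arrival are `e^{-i(13/8)Θ}·(d_s², d_s, 1)`
and the `rowD`-weight of `ω` is `e^{-i(13/8)Θ} x_c^{ℓ+1} · [(1/3) ē²d_s² + c₁ ē d_s + c₂]`.  DARTS: for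
`s = v`, `d_s = -e` and the bracket is `1/3 - c₁ + c₂ = 0` (`2x_c cos(π/8) = 1`); for `s = ρv, ρ²v`
(`ρ = rot3 t`), `d_s = e^{∓iπ/3} e`, `τ(s) = ±π/3`, and the bracket equals `x_c e^{-i(13/8)τ(s)}`
(`rowD_coeff_minus`, `rowD_coeff_plus`) — exactly the via-weight of `ω ++ [t]` (`rowD_term`).

Sources: H. Duminil-Copin, S. Smirnov, Ann. of Math. 175 (2012) (arXiv:1007.0575), §2 (windings, proof
of Lemma 1); the line card `Lines/sector-slaving.md`.
-/

noncomputable section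

open scoped BigOperators ComplexConjugate Classical
open Literature.Probability.LatticeModels Literature.Probability.RandomPlanarGeometry.SAW
open Summit.CriticalPhenomena.SAWScalingLimit.Theorems.DefectDecoherence.TipMartingale
open Summit.CriticalPhenomena.SAWScalingLimit.Theorems.SpinShift

namespace Summit.CriticalPhenomena.SAWScalingLimit.Theorems.DefectDecoherence.SectorSlaving

/-! ### Constants -/

/-- `x_c cos(π/8) = 1/2`, i.e. `2 x_c cos(π/8) = 1` (`x_c = 1/√(2+√2)`, `2cos(π/8) = √(2+√2)`).
[folklore] -/
theorem rowD_xc_mul_cos : xc * Real.cos (Real.pi / 8) = 1 / 2 := by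
  have h0 : 0 < Real.sqrt (2 + Real.sqrt 2) := Real.sqrt_pos.2 (by positivity)
  rw [show (xc : ℝ) = (Real.sqrt (2 + Real.sqrt 2))⁻¹ from rfl, Real.cos_pi_div_eight]
  calc (Real.sqrt (2 + Real.sqrt 2))⁻¹ * (Real.sqrt (2 + Real.sqrt 2) / 2)
      = (Real.sqrt (2 + Real.sqrt 2))⁻¹ * Real.sqrt (2 + Real.sqrt 2) / 2 := by ring
    _ = 1 / 2 := by rw [inv_mul_cancel₀ h0.ne']

/-- `cos(5π/24) = (√3/2) sin(π/8) + (1/2) cos(π/8)` (`5π/24 = (π/2 - π/8) - π/6`). [folklore] -/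
theorem rowD_cos_five : Real.cos (5 * Real.pi / 24) =
    Real.sqrt 3 / 2 * Real.sin (Real.pi / 8) + 1 / 2 * Real.cos (Real.pi / 8) := by
  rw [show 5 * Real.pi / 24 = (Real.pi / 2 - Real.pi / 8) - Real.pi / 6 by ring, Real.cos_sub,
    Real.cos_pi_div_two_sub, Real.sin_pi_div_two_sub, Real.cos_pi_div_six, Real.sin_pi_div_six]
  ring

/-- `cos(13π/24) = (√3/2) sin(π/8) - (1/2) cos(π/8)` (`13π/24 = (π/2 - π/8) + π/6`). [folklore] -/
theorem rowD_cos_thirteen : Real.cos (13 * Real.pi / 24) =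
    Real.sqrt 3 / 2 * Real.sin (Real.pi / 8) - 1 / 2 * Real.cos (Real.pi / 8) := by
  rw [show 13 * Real.pi / 24 = (Real.pi / 2 - Real.pi / 8) + Real.pi / 6 by ring, Real.cos_add,
    Real.cos_pi_div_two_sub, Real.sin_pi_div_two_sub, Real.cos_pi_div_six, Real.sin_pi_div_six]
  ring

/-- `sin(13π/24) = (√3/2) cos(π/8) + (1/2) sin(π/8)`. [folklore] -/
theorem rowD_sin_thirteen : Real.sin (13 * Real.pi / 24) =
    Real.sqrt 3 / 2 * Real.cos (Real.pi / 8) + 1 / 2 * Real.sin (Real.pi / 8) := by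
  rw [show 13 * Real.pi / 24 = (Real.pi / 2 - Real.pi / 8) + Real.pi / 6 by ring, Real.sin_add,
    Real.cos_pi_div_two_sub, Real.sin_pi_div_two_sub, Real.cos_pi_div_six, Real.sin_pi_div_six]
  ring

/-- `e^{-iπ/3} = 1/2 - (√3/2) i`. [folklore] -/
theorem rowD_exp_neg_pi_div_three : Complex.exp (((-(Real.pi / 3) : ℝ) : ℂ) * Complex.I) =
    ((1 / 2 : ℝ) : ℂ) - ((Real.sqrt 3 / 2 : ℝ) : ℂ) * Complex.I := by
  apply Complex.ext
  · rw [Complex.exp_ofReal_mul_I_re, Real.cos_neg, Real.cos_pi_div_three]; simp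
  · rw [Complex.exp_ofReal_mul_I_im, Real.sin_neg, Real.sin_pi_div_three]; simp

/-- `e^{iπ/3} = 1/2 + (√3/2) i`. [folklore] -/
theorem rowD_exp_pi_div_three : Complex.exp (((Real.pi / 3 : ℝ) : ℂ) * Complex.I) =
    ((1 / 2 : ℝ) : ℂ) + ((Real.sqrt 3 / 2 : ℝ) : ℂ) * Complex.I := by
  apply Complex.ext
  · rw [Complex.exp_ofReal_mul_I_re, Real.cos_pi_div_three]; simp
  · rw [Complex.exp_ofReal_mul_I_im, Real.sin_pi_div_three]; simp

/-- The `D`-character of the turn `+π/3`: `e^{-i(13/8)(π/3)} = cos(13π/24) - i sin(13π/24)`.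
[folklore] -/
theorem rowD_exp_turn_pos :
    Complex.exp (-Complex.I * ((13 / 8 : ℝ) : ℂ) * ((Real.pi / 3 : ℝ) : ℂ)) =
      ((Real.cos (13 * Real.pi / 24) : ℝ) : ℂ) - ((Real.sin (13 * Real.pi / 24) : ℝ) : ℂ) * Complex.I := by
  have h : -Complex.I * ((13 / 8 : ℝ) : ℂ) * ((Real.pi / 3 : ℝ) : ℂ) =
      ((-(13 * Real.pi / 24) : ℝ) : ℂ) * Complex.I := by push_cast; ring
  rw [h]
  apply Complex.ext
  · rw [Complex.exp_ofReal_mul_I_re, Real.cos_neg]; simp [-Complex.ofReal_cos, -Complex.ofReal_sin]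
  · rw [Complex.exp_ofReal_mul_I_im, Real.sin_neg]; simp [-Complex.ofReal_cos, -Complex.ofReal_sin]

/-- The `D`-character of the turn `-π/3`: `e^{-i(13/8)(-π/3)} = cos(13π/24) + i sin(13π/24)`.
[folklore] -/
theorem rowD_exp_turn_neg :
    Complex.exp (-Complex.I * ((13 / 8 : ℝ) : ℂ) * ((-(Real.pi / 3) : ℝ) : ℂ)) =
      ((Real.cos (13 * Real.pi / 24) : ℝ) : ℂ) + ((Real.sin (13 * Real.pi / 24) : ℝ) : ℂ) * Complex.I := by
  have h : -Complex.I * ((13 / 8 : ℝ) : ℂ) * ((-(Real.pi / 3) : ℝ) : ℂ) =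
      ((13 * Real.pi / 24 : ℝ) : ℂ) * Complex.I := by push_cast; ring
  rw [h]
  apply Complex.ext
  · rw [Complex.exp_ofReal_mul_I_re]; simp [-Complex.ofReal_cos, -Complex.ofReal_sin]
  · rw [Complex.exp_ofReal_mul_I_im]; simp [-Complex.ofReal_cos, -Complex.ofReal_sin]

/-- The reversed dart contributes nothing: `1/3 - 2x_c cos(5π/24)/3 + 2x_c cos(13π/24)/3 = 0`
(`cos(5π/24) - cos(13π/24) = cos(π/8)` and `2x_c cos(π/8) = 1`). [folklore] -/
theorem rowD_coeff_zero : (1 / 3 : ℂ) - ((2 * xc * Real.cos (5 * Real.pi / 24) / 3 : ℝ) : ℂ) +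
    ((2 * xc * Real.cos (13 * Real.pi / 24) / 3 : ℝ) : ℂ) = 0 := by
  rw [rowD_cos_five, rowD_cos_thirteen]
  have h1 : (xc : ℂ) * ((Real.cos (Real.pi / 8) : ℝ) : ℂ) = 1 / 2 := by
    rw [← Complex.ofReal_mul, rowD_xc_mul_cos]; norm_num
  set s := Real.sin (Real.pi / 8) with hs
  set c := Real.cos (Real.pi / 8) with hc
  set r := Real.sqrt 3 with hr
  push_cast
  linear_combination (-2 / 3 : ℂ) * h1

/-- **Dart character, turn `+π/3`.**  For the dart `ρv → t` (`d = e^{-iπ/3} e`):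
`(1/3) e^{-2iπ/3} + c₁ e^{-iπ/3} + c₂ = x_c e^{-i(13/8)(π/3)}`, `c₁ = 2x_c cos(5π/24)/3`,
`c₂ = 2x_c cos(13π/24)/3`. [folklore] -/
theorem rowD_coeff_minus :
    (1 / 3 : ℂ) * Complex.exp (((-(Real.pi / 3) : ℝ) : ℂ) * Complex.I) ^ 2 +
        ((2 * xc * Real.cos (5 * Real.pi / 24) / 3 : ℝ) : ℂ) *
          Complex.exp (((-(Real.pi / 3) : ℝ) : ℂ) * Complex.I) +
      ((2 * xc * Real.cos (13 * Real.pi / 24) / 3 : ℝ) : ℂ) =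
    (xc : ℂ) * Complex.exp (-Complex.I * ((13 / 8 : ℝ) : ℂ) * ((Real.pi / 3 : ℝ) : ℂ)) := by
  rw [rowD_exp_neg_pi_div_three, rowD_exp_turn_pos, rowD_cos_five, rowD_cos_thirteen,
    rowD_sin_thirteen]
  have h1 : (xc : ℂ) * ((Real.cos (Real.pi / 8) : ℝ) : ℂ) = 1 / 2 := by
    rw [← Complex.ofReal_mul, rowD_xc_mul_cos]; norm_num
  have h3 : ((Real.sqrt 3 : ℝ) : ℂ) * ((Real.sqrt 3 : ℝ) : ℂ) = 3 := by
    rw [← Complex.ofReal_mul, Real.mul_self_sqrt (by norm_num : (0 : ℝ) ≤ 3)]; norm_num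
  set s := Real.sin (Real.pi / 8) with hs
  set c := Real.cos (Real.pi / 8) with hc
  set r := Real.sqrt 3 with hr
  push_cast
  linear_combination (1 / 3 + (r : ℂ) * Complex.I / 3) * h1 +
    (Complex.I ^ 2 / 12 - (xc : ℂ) * (s : ℂ) * Complex.I / 6) * h3 + (1 / 4 : ℂ) * Complex.I_mul_I

/-- **Dart character, turn `-π/3`.**  For the dart `ρ²v → t` (`d = e^{iπ/3} e`):
`(1/3) e^{2iπ/3} + c₁ e^{iπ/3} + c₂ = x_c e^{-i(13/8)(-π/3)}`. [folklore] -/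
theorem rowD_coeff_plus :
    (1 / 3 : ℂ) * Complex.exp (((Real.pi / 3 : ℝ) : ℂ) * Complex.I) ^ 2 +
        ((2 * xc * Real.cos (5 * Real.pi / 24) / 3 : ℝ) : ℂ) *
          Complex.exp (((Real.pi / 3 : ℝ) : ℂ) * Complex.I) +
      ((2 * xc * Real.cos (13 * Real.pi / 24) / 3 : ℝ) : ℂ) =
    (xc : ℂ) * Complex.exp (-Complex.I * ((13 / 8 : ℝ) : ℂ) * ((-(Real.pi / 3) : ℝ) : ℂ)) := by
  rw [rowD_exp_pi_div_three, rowD_exp_turn_neg, rowD_cos_five, rowD_cos_thirteen,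
    rowD_sin_thirteen]
  have h1 : (xc : ℂ) * ((Real.cos (Real.pi / 8) : ℝ) : ℂ) = 1 / 2 := by
    rw [← Complex.ofReal_mul, rowD_xc_mul_cos]; norm_num
  have h3 : ((Real.sqrt 3 : ℝ) : ℂ) * ((Real.sqrt 3 : ℝ) : ℂ) = 3 := by
    rw [← Complex.ofReal_mul, Real.mul_self_sqrt (by norm_num : (0 : ℝ) ≤ 3)]; norm_num
  set s := Real.sin (Real.pi / 8) with hs
  set c := Real.cos (Real.pi / 8) with hc
  set r := Real.sqrt 3 with hr
  push_cast
  linear_combination (1 / 3 - (r : ℂ) * Complex.I / 3) * h1 +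
    (Complex.I ^ 2 / 12 + (xc : ℂ) * (s : ℂ) * Complex.I / 6) * h3 + (1 / 4 : ℂ) * Complex.I_mul_I

/-! ### The three darts at a vertex `t ∼ v` -/

/-- Reversing a dart negates its unit vector: `dartUnit t v = -dartUnit v t`. [folklore] -/
theorem rowD_dartUnit_swap (v t : HexVertex) : dartUnit t v = -dartUnit v t := by
  unfold dartUnit
  rw [norm_sub_rev (hexCenter t) (hexCenter v)]
  ring

/-- A dart unit vector is unimodular: `conj(e) · e = 1`. [folklore] -/
theorem rowD_conj_dartUnit_mul {v t : HexVertex} (hvt : hexGraph.Adj v t) :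
    starRingEnd ℂ (dartUnit v t) * dartUnit v t = 1 := by
  have h0 : hexCenter v - hexCenter t ≠ 0 := hexCenter_sub_ne_zero_of_adj hvt.symm
  have hn : ((‖hexCenter v - hexCenter t‖ : ℝ) : ℂ) ≠ 0 := by exact_mod_cast norm_ne_zero_iff.2 h0
  unfold dartUnit
  rw [map_div₀, Complex.conj_ofReal, div_mul_div_comm, Complex.conj_mul', sq,
    div_self (mul_ne_zero hn hn)]

/-- The dart `ρv → t` (`ρ = rot3 t`) points along `e^{-iπ/3} e(t)`:
`dartUnit t (ρ v) = e^{-iπ/3} · dartUnit v t`. [folklore] -/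
theorem rowD_dartUnit_rot3 (v t : HexVertex) :
    dartUnit t (rot3 t v) = Complex.exp (((-(Real.pi / 3) : ℝ) : ℂ) * Complex.I) * dartUnit v t := by
  have h := tip_hexCenter_rot3_sub t v
  have e1 : hexCenter t - hexCenter (rot3 t v) =
      Complex.exp (((-(Real.pi / 3) : ℝ) : ℂ) * Complex.I) * (hexCenter v - hexCenter t) := by
    linear_combination (-1 : ℂ) * h
  unfold dartUnit
  rw [e1, norm_mul, Complex.norm_exp_ofReal_mul_I, one_mul, mul_div_assoc]

/-- The dart `ρ²v → t` points along `e^{iπ/3} e(t)`: `dartUnit t (ρ² v) = e^{iπ/3} · dartUnit v t`.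
[folklore] -/
theorem rowD_dartUnit_rot3_rot3 (v t : HexVertex) :
    dartUnit t (rot3 t (rot3 t v)) =
      Complex.exp (((Real.pi / 3 : ℝ) : ℂ) * Complex.I) * dartUnit v t := by
  have h := tip_hexCenter_rot3_rot3_sub t v
  have e1 : hexCenter t - hexCenter (rot3 t (rot3 t v)) =
      Complex.exp (((Real.pi / 3 : ℝ) : ℂ) * Complex.I) * (hexCenter v - hexCenter t) := by
    linear_combination (-1 : ℂ) * h
  unfold dartUnit
  rw [e1, norm_mul, Complex.norm_exp_ofReal_mul_I, one_mul, mul_div_assoc]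

/-- Entering `t` from `ρv` and leaving towards `mid{v,t}` turns by `+π/3`. [folklore] -/
theorem rowD_turning_rot3 {v t : HexVertex} (hvt : hexGraph.Adj v t) :
    turning (hexCenter (rot3 t v)) (hexCenter t) (hexMidpoint s(v, t)) = Real.pi / 3 := by
  have hadj : hexGraph.Adj t (rot3 t v) := (tip_adj_iff hvt.symm _).2 (Or.inr (Or.inl rfl))
  have h := tip_turning_rot3_rot3 hadj
  rwa [rot3_rot3_rot3] at h

/-- Entering `t` from `ρ²v` and leaving towards `mid{v,t}` turns by `-π/3`. [folklore] -/
theorem rowD_turning_rot3_rot3 {v t : HexVertex} (hvt : hexGraph.Adj v t) :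
    turning (hexCenter (rot3 t (rot3 t v))) (hexCenter t) (hexMidpoint s(v, t)) = -(Real.pi / 3) := by
  have hadj : hexGraph.Adj t (rot3 t (rot3 t v)) := (tip_adj_iff hvt.symm _).2 (Or.inr (Or.inr rfl))
  have h := tip_turning_rot3 hadj
  rwa [rot3_rot3_rot3] at h

/-! ### The `rowD`-weight of one clean arrival at `t` -/

/-- **Per-walk identity.**  For an arrival `ω : s(u,w) → s(s,t)` at `t ∼ v` through the dart `s → t`
(last vertex `s`), the `rowD`-combination of its three characters,
`(1/3) ē² · X_{-3/8}(ω) + c₁ ē · X_{5/8}(ω) + c₂ · X_{13/8}(ω)` (`e = dartUnit v t`,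
`X_ξ(ω) = x_c^{ℓ+1} e^{-iξΘ(ω)}`), vanishes for the reversed dart `s = v` and equals the via-weight
`x_c^{ℓ+2} e^{-i(13/8)Θ(ω ++ [t])}` of the prolonged walk `ω ++ [t] → mid{t,v}` for the two other
darts. [folklore] -/
theorem rowD_term {Λ : Finset HexVertex} {u w v t s : HexVertex} (huw : hexGraph.Adj u w)
    (hu : u ∉ Λ) (hvt : hexGraph.Adj v t) (hts : hexGraph.Adj t s)
    (ω : HexMidEdgeSAW Λ s(u, w) s(s, t)) (hlast : ω.verts.getLast? = some s) :
    (1 / 3 : ℂ) * (starRingEnd ℂ (dartUnit v t)) ^ 2 *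
          ((xc : ℂ) ^ (ω.length + 1) *
            Complex.exp (-Complex.I * ((-3 / 8 : ℝ) : ℂ) * ((rootAngle u w + ω.winding : ℝ) : ℂ))) +
        ((2 * xc * Real.cos (5 * Real.pi / 24) / 3 : ℝ) : ℂ) * starRingEnd ℂ (dartUnit v t) *
          ((xc : ℂ) ^ (ω.length + 1) *
            Complex.exp (-Complex.I * ((5 / 8 : ℝ) : ℂ) * ((rootAngle u w + ω.winding : ℝ) : ℂ))) +
      ((2 * xc * Real.cos (13 * Real.pi / 24) / 3 : ℝ) : ℂ) *
        ((xc : ℂ) ^ (ω.length + 1) *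
          Complex.exp (-Complex.I * ((13 / 8 : ℝ) : ℂ) * ((rootAngle u w + ω.winding : ℝ) : ℂ))) =
    if s = v then 0 else
      (xc : ℂ) ^ ((ω.verts ++ [t]).length + 1) *
        Complex.exp (-Complex.I * ((13 / 8 : ℝ) : ℂ) *
          ((rootAngle u w + winding (hexMidpoint s(u, w) :: (ω.verts ++ [t]).map hexCenter ++
            [hexMidpoint s(v, t)]) : ℝ) : ℂ)) := by
  -- the lifted direction of the arrival dart `s → t`
  have hd := tip_exp_lifted_direction huw hu hts.symm ω hlast
  have h1 := rowD_conj_dartUnit_mul hvt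
  set e := dartUnit v t with he
  set Θ : ℝ := rootAngle u w + ω.winding with hΘ
  set E := Complex.exp (-Complex.I * ((13 / 8 : ℝ) : ℂ) * (Θ : ℂ)) with hE
  have hU : Complex.exp (-Complex.I * ((-3 / 8 : ℝ) : ℂ) * (Θ : ℂ)) =
      E * Complex.exp ((Θ : ℂ) * Complex.I) ^ 2 := by
    rw [hE, sq, ← Complex.exp_add, ← Complex.exp_add]
    congr 1
    push_cast
    ring
  have hS : Complex.exp (-Complex.I * ((5 / 8 : ℝ) : ℂ) * (Θ : ℂ)) =
      E * Complex.exp ((Θ : ℂ) * Complex.I) := by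
    rw [hE, ← Complex.exp_add]
    congr 1
    push_cast
    ring
  have hsplit : ∀ τ : ℝ, Complex.exp (-Complex.I * ((13 / 8 : ℝ) : ℂ) *
      ((rootAngle u w + (ω.winding + τ) : ℝ) : ℂ)) =
      E * Complex.exp (-Complex.I * ((13 / 8 : ℝ) : ℂ) * (τ : ℂ)) := by
    intro τ
    rw [hE, hΘ, ← Complex.exp_add]
    congr 1
    push_cast
    ring
  rw [hU, hS, hd]
  -- the walk prolonged by `t`
  obtain ⟨L, hL⟩ : ∃ L, ω.verts = L ++ [s] := ⟨_, (List.dropLast_append_getLast? s hlast).symm⟩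
  have hW : ω.winding = winding (hexMidpoint s(u, w) :: (L ++ [s]).map hexCenter ++
      [hexMidpoint s(s, t)]) := by
    rw [HexMidEdgeSAW.winding, HexMidEdgeSAW.points, hL]
  have hlen : (L ++ [s] ++ [t]).length = ω.length + 1 := by
    rw [HexMidEdgeSAW.length, hL]; simp
  rw [hL, tip_winding_snoc, ← hW, hlen]
  -- the three darts at `t`
  rcases (tip_adj_iff hvt.symm s).1 hts with h | h | h
  · -- the reversed dart `v → t`
    have hds : dartUnit t s = -e := by rw [h, he]; exact rowD_dartUnit_swap v t
    rw [if_pos h, hds]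
    linear_combination ((xc : ℂ) ^ (ω.length + 1) * E *
        ((1 / 3 : ℂ) * (starRingEnd ℂ e * e + 1) -
          ((2 * xc * Real.cos (5 * Real.pi / 24) / 3 : ℝ) : ℂ))) * h1 +
      ((xc : ℂ) ^ (ω.length + 1) * E) * rowD_coeff_zero
  · -- the dart `ρv → t`: turn `+π/3`
    have hne : s ≠ v := by rw [h]; exact (tip_rot3_ne hvt.symm).1.symm
    have hds : dartUnit t s = Complex.exp (((-(Real.pi / 3) : ℝ) : ℂ) * Complex.I) * e := by
      rw [h, he]; exact rowD_dartUnit_rot3 v t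
    have hτ : turning (hexCenter s) (hexCenter t) (hexMidpoint s(v, t)) = Real.pi / 3 := by
      rw [h]; exact rowD_turning_rot3 hvt
    rw [if_neg hne, hτ, hsplit, hds]
    linear_combination ((xc : ℂ) ^ (ω.length + 1) * E *
        ((1 / 3 : ℂ) * Complex.exp (((-(Real.pi / 3) : ℝ) : ℂ) * Complex.I) ^ 2 *
            (starRingEnd ℂ e * e + 1) +
          ((2 * xc * Real.cos (5 * Real.pi / 24) / 3 : ℝ) : ℂ) *
            Complex.exp (((-(Real.pi / 3) : ℝ) : ℂ) * Complex.I))) * h1 +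
      ((xc : ℂ) ^ (ω.length + 1) * E) * rowD_coeff_minus
  · -- the dart `ρ²v → t`: turn `-π/3`
    have hne : s ≠ v := by rw [h]; exact (tip_rot3_ne hvt.symm).2.1.symm
    have hds : dartUnit t s = Complex.exp (((Real.pi / 3 : ℝ) : ℂ) * Complex.I) * e := by
      rw [h, he]; exact rowD_dartUnit_rot3_rot3 v t
    have hτ : turning (hexCenter s) (hexCenter t) (hexMidpoint s(v, t)) = -(Real.pi / 3) := by
      rw [h]; exact rowD_turning_rot3_rot3 hvt
    rw [if_neg hne, hτ, hsplit, hds]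
    linear_combination ((xc : ℂ) ^ (ω.length + 1) * E *
        ((1 / 3 : ℂ) * Complex.exp (((Real.pi / 3 : ℝ) : ℂ) * Complex.I) ^ 2 *
            (starRingEnd ℂ e * e + 1) +
          ((2 * xc * Real.cos (5 * Real.pi / 24) / 3 : ℝ) : ℂ) *
            Complex.exp (((Real.pi / 3 : ℝ) : ℂ) * Complex.I))) * h1 +
      ((xc : ℂ) ^ (ω.length + 1) * E) * rowD_coeff_plus

/-! ### The stub -/

/-- **The exact `D`-row** (stub `stub_sectorRowD` of the line `sector-slaving`): at a `2`-deep vertex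
`v`, `Ā_D(v) = Σ_{t ∼ v} [(1/3) ē(t)² U(t) + (2x_c cos(5π/24)/3) ē(t) S(t) + (2x_c cos(13π/24)/3) D(t)]`.
[folklore] -/
theorem stub_sectorRowD :
    ∀ (Λ : Finset HexVertex) (u w : HexVertex), hexGraph.Adj u w → u ∉ Λ → w ∈ Λ →
      ∀ v : HexVertex, Deep Λ v 2 →
        viaSum Λ s(u, w) (rootAngle u w) (13 / 8) v = rowD Λ u w v := by
  intro Λ u w huw hu _ v hdeep
  have hv : v ∈ Λ := hdeep v (by simp)
  unfold viaSum rowD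
  refine Finset.sum_congr rfl fun t ht => ?_
  obtain ⟨htΛ, hvt⟩ := tip_mem_star.1 ht
  -- `u` is far from `v`, so the root vertex `w` is not the neighbour `t`
  have hwt : w ≠ t := by
    rintro rfl
    refine hu (hdeep u ?_)
    linarith [dist_triangle (hexCenter u) (hexCenter w) (hexCenter v),
      dist_hexCenter_le_one_of_adj huw, dist_hexCenter_le_one_of_adj hvt.symm]
  have hv' : v ∈ star Λ t := tip_mem_star.2 ⟨hv, hvt.symm⟩
  -- via-`t` walks at `mid{t,v}` = clean arrivals at `t` through `s → t`, `s ≠ v`, prolonged by `t`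
  rw [Sym2.eq_swap (a := t) (b := v)]
  refine (tip_sum_viaV hu htΛ hwt hv' (fun l => (xc : ℂ) ^ (l.length + 1) *
    Complex.exp (-Complex.I * ((13 / 8 : ℝ) : ℂ) * ((rootAngle u w +
      winding (hexMidpoint s(u, w) :: l.map hexCenter ++ [hexMidpoint s(v, t)]) : ℝ) : ℂ)))).trans ?_
  -- distribute `rowD` over the arrivals at `t`
  unfold arrivalSum
  simp only [Finset.mul_sum, ← Finset.sum_add_distrib]
  refine Finset.sum_congr rfl fun s hs => Finset.sum_congr rfl fun ω _ => ?_
  obtain ⟨-, hts⟩ := tip_mem_star.1 hs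
  by_cases hc : ω.verts.getLast? = some s ∧ t ∉ ω.verts
  · simp only [if_pos hc]
    exact (rowD_term huw hu hvt hts ω hc.1).symm
  · simp only [if_neg hc, mul_zero, add_zero]

end Summit.CriticalPhenomena.SAWScalingLimit.Theorems.DefectDecoherence.SectorSlaving

end
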